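import Literature.NumberTheory.EllipticCurves.TwistedHeegnerTransportGalois
import Literature.NumberTheory.EllipticCurves.RingClassGenusCharacter
import Literature.NumberTheory.EllipticCurves.RingClassFieldTower
import Literature.NumberTheory.EllipticCurves.QuadraticTwistRank
import HarnessLib

/-!
# Twisted Heegner families exist: the non-vacuity of `TwistedHeegnerFamily N′ W W′ K κ jbar` for
# the quadratic twist `E′ = E^{(p*)}` (Keller–Yin 2024b, Case (I)) — theorems + one definition

Cross-ladder LITERATURE-TYPING layer (D-0088(4)), cell `bsd-littype`, seat `bsd-littype-06` (gen 4).
Sequel of `TwistedHeegnerModule.lean` (the DEFINITION of the twisted family and its Heegner module),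
`TwistedHeegnerTransportGalois.lean` (`σ(θ_C x) = θ_{σC}(σx)`) and `RingClassGenusCharacter.lean`
(the genus datum `√p* ∈ K[p]`), all of this seat: it closes the cell's tree task OPEN-QUESTIONS-06
Q-D4 — **the hypotheses of the typed Keller–Yin statements `thm336_hpmc_divisibility_OPEN`,
`thm351_hpmc_equality_OPEN`, `prop344_grMC_of_hpmc_OPEN` (file
`KellerYin2024/PotentiallyGoodOrdinaryHeegnerPointMainConjecture.lean`), which quantify over ALL
twisted Heegner families `F`, are NOT vacuous**: under the Heegner hypothesis for `N′` with `p ∤ N′`,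
`p` odd, `p ∤ d_K`, and `W′ ≅_ℚ W^{(p*)}`, for every parametrisation datum `Dt′` of `E′` at level `N′`,
orientation `β`, embedding `jbar : K̄ → ℂ` and `ℤ_p`-extension `κ` there IS a
`TwistedHeegnerFamily N′ W W′ K κ jbar` (`nonempty_twistedHeegnerFamily_of`), CONDITIONALLY on the two
refereed named facts the construction rests on — `exists_isHeegnerNormPoint N′ W′ K p` (Heegner points
of `E′` of every conductor prime to `N′` are `K[c]`-rational and have norms to the layers; Howard 2004
§2.7/§3.3, Gross 1991 §3) and `sqrt_pStar_mem_ringClassField` (`√p* ∈ K[p]`; Cornut–Vatsal 2007 §1.1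
with Cox §8–§11) — and on nothing else. No new fact (D-0026): net debt `0`.

## The printed construction being followed (Keller–Yin arXiv:2410.23241v1 §3.1, proof of Thm. 3.3.5,
## p0018 L14; Castella–Hsieh 2018 §4.4), read at Case (I) for an elliptic curve

`E′ = E^{(p*)}` is GOOD ordinary at `p`, `p ∤ N′ = N(E′)`, so the classical Heegner points
`P′[c] ∈ E′(K[c])` of conductor `c = p^{j+1}` exist (CM theory: `exists_isHeegnerNormPoint N′ W′ K p`);
`E ≅ E′` over `ℚ(√p*)`, the isomorphism being the twisting substitution `u = √p*` composed with
`ℚ`-rational substitutions (Silverman X.5.4; tree `twistUntwist_smul_baseChange`,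
`exists_variableChange_quadraticTwist_one`) — here `GeomTransport.ofQuadraticTwist`, a `K̄`-isomorphism
whose coefficients lie in `ℚ(δ)`, `δ² = p*`; by genus theory `√p* ∈ K[p] ⊆ K[p^{j+1}]`
(`sqrt_pStar_mem_ringClassField` + the tree's tower theorem `ringClassField_mono`), so `θ_C` is
`Gal(K̄/K[p^{j+1}])`-equivariant (`GeomTransport.smul_equiv_eq_self_of`) and `θ_C(P′[p^{j+1}])` is again
`K[p^{j+1}]`-rational; its norm to `K_j` over the same transversal as for `P′` is the required point
`z_j` (`IsTwistedHeegnerNormPoint`).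

## What had to be proved on the way (the "jbar-transfer", §1)

The tree has TWO incarnations of the ring class field of conductor `c`: the concrete subfield
`ringClassField K ι c = ι(K)(j(𝒪_c)-singular moduli) ⊆ ℂ` (`HeegnerPointsOfConductor.lean`, with the
tower/degree theory of `RingClassFieldTower.lean`) and the subgroup
`ringClassSubgroup K c jbar = Gal(K̄/K[c]) ≤ Γ_K` (`HeegnerModuleIndex.lean`: the elements fixing every
`a ∈ K̄` whose `jbar`-image is a singular modulus of discriminant `d_K c²`), so far unrelated by any
lemma. §1 proves the bridge: every element of `ℂ` algebraic over `ℚ` is a value of `jbar`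
(`mem_range_of_isAlgebraic`), hence `ringClassField K ι c ⊆ jbar(K̄)` for `ι = jbar ∘ (K → K̄)`
(`K[c]/K` is finite), and **`σ ∈ ringClassSubgroup K c jbar` fixes every `δ ∈ K̄` with
`jbar δ ∈ ringClassField K ι c`** (`smul_eq_self_of_mem_ringClassSubgroup`: the `jbar`-image of the
fixed field of `σ` is a subfield of `ℂ` containing `ι(K)` and the singular moduli).

Scope: `K : Type` (universe `0`) in the final theorem, because `sqrt_pStar_mem_ringClassField`
quantifies over `K : Type` (§1–§2 are universe-polymorphic); the parametrisation datum `Dt′` and the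
orientation `β` are INPUTS (as in the sibling `nonempty_heegnerFamily_of`; their existence is
modularity and `exists_dvd_sq_sub_discr_of_ncard_primesOver`); nothing is said about non-torsionness
of the family (Cornut–Vatsal 2007 Thm. 1.10; OPEN-QUESTIONS-06 Q-D1) — existence only.

## References

* [SilvermanAEC2009] J. H. Silverman, *The Arithmetic of Elliptic Curves*, 2nd ed., III.1, X.2
  (proof of Prop. 2.4), X.5 Cor. 5.4 (the twist isomorphism over `F(√d)`).
* [Howard2004HeegnerKolyvagin] B. Howard, *The Heegner point Kolyvagin system*, Compos. Math. 140
  (2004), §2.7, §3.3 (`P[m] ∈ E(K[m])`, the norms `Norm_{K[p^{k+1}]/K_k}`).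
* [Cox2013] D. A. Cox, *Primes of the form x² + ny²*, 2nd ed., Thm. 11.1, §9.A (`K[m] ⊆ K[n]`).
* [CornutVatsal2007] C. Cornut, V. Vatsal, *Nontriviality of Rankin–Selberg L-functions and CM points*,
  LMS LN 320 (2007), §1.1 (ring class characters; the genus character of conductor `p`).
* [CastellaHsieh2018] F. Castella, M.-L. Hsieh, Math. Ann. 370 (2018), §4.4 (`z_{f,χ,c}`); Keller–Yin,
  arXiv:2410.23241v1, proof of Thm. 3.3.5 (p0018 L14) — UNREFEREED, only the construction it names is used.
-/

set_option autoImplicit false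

noncomputable section

open scoped Classical

open Polynomial WeierstrassCurve

universe u

namespace Literature.NumberTheory.EllipticCurves

open ModularForms
open Literature.NumberTheory.QuadraticFields.BinaryQuadraticForm (reducedForms)

/-! ## §1 Algebraic numbers are values of `jbar`; `K[c] ⊆ jbar(K̄)`; the `jbar`-transfer -/

section Range

/-- **Every element algebraic over `F` of a field `M` is a value of any `F`-embedding of an
algebraically closed `F`-field `L`**: the roots of a polynomial split in `L` map ONTO its roots in
`M` (Mathlib `Polynomial.Splits.image_rootSet`). Applied below with `F = ℚ`, `L = K̄`, `M = ℂ`.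
(Copies exist in unrelated topics of the tree, e.g. `GenEll.De.mem_range_of_isAlgebraic`; not imported.)
A consequence of Lang, *Algebra*, Ch. V §2 Thm. 2.8 (`φ(L)` is algebraically closed in `M`).
[cite: Lang2002, Ch. V §2 Thm. 2.8 (consequence: algebraic elements lie in the image)] -/
theorem mem_range_of_isAlgebraic {F : Type*} {L : Type*} {M : Type*} [Field F] [Field L] [Field M]
    [Algebra F L] [Algebra F M] [IsAlgClosed L] (φ : L →ₐ[F] M) {x : M} (hx : IsAlgebraic F x) :
    x ∈ Set.range φ := by
  obtain ⟨f, hf0, hfx⟩ := hx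
  have hx' : x ∈ f.rootSet M := Polynomial.mem_rootSet.mpr ⟨hf0, hfx⟩
  rw [← (IsAlgClosed.splits (f.map (algebraMap F L))).image_rootSet φ] at hx'
  obtain ⟨y, -, hy⟩ := hx'
  exact ⟨y, hy⟩

variable {K : Type u} [Field K] [NumberField K]

/-- **`K[c] ⊆ jbar(K̄)`**: for `K` imaginary quadratic, `c ≠ 0` and any embedding `jbar : K̄ → ℂ`,
every element of the ring class field `ringClassField K ι c ⊆ ℂ` built on `ι = jbar ∘ (K → K̄)` is a
value of `jbar` — `K[c]/K` is finite (`finiteDimensional_and_isGalois_ringClassField`, Cox §9.A), so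
its elements are algebraic over `ℚ`. [cite: Cox2013, Thm. 11.1 (j(𝔞) is an algebraic integer; K(j(𝔞)) = K[c])] -/
theorem mem_range_of_mem_ringClassField (hK : IsImaginaryQuadratic K)
    (jbar : AlgebraicClosure K →+* ℂ) {c : ℕ} (hc : c ≠ 0) {x : ℂ}
    (hx : x ∈ ringClassField K (jbar.comp (algebraMap K (AlgebraicClosure K))) c) :
    x ∈ Set.range jbar := by
  set ι := jbar.comp (algebraMap K (AlgebraicClosure K))
  haveI := (finiteDimensional_and_isGalois_ringClassField hK ι hc).1
  haveI : Algebra.IsAlgebraic K (ringClassField K ι c) := Algebra.IsAlgebraic.of_finite K _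
  haveI : Algebra.IsAlgebraic ℚ (ringClassField K ι c) := Algebra.IsAlgebraic.trans ℚ K _
  have halg : IsAlgebraic ℚ (⟨x, hx⟩ : ringClassField K ι c) := Algebra.IsAlgebraic.isAlgebraic _
  have halg' : IsAlgebraic ℚ x := halg.algHom ((ringClassField K ι c).subtype.toRatAlgHom)
  obtain ⟨y, hy⟩ := mem_range_of_isAlgebraic jbar.toRatAlgHom halg'
  exact ⟨y, hy⟩

/-- **The fixed field of `σ ∈ Γ_K` in `K̄`** (plumbing: the subfield `{a | σ • a = a}`; `σ` acts by a
`K`-algebra automorphism, `Field.absoluteGaloisGroup.smul_def`). [folklore] -/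
def galoisFixedSubfield (σ : Field.absoluteGaloisGroup K) : Subfield (AlgebraicClosure K) where
  carrier := {a | σ • a = a}
  mul_mem' {a b} ha hb := by
    simp only [Set.mem_setOf_eq, Field.absoluteGaloisGroup.smul_def] at ha hb ⊢
    rw [map_mul, ha, hb]
  one_mem' := by
    simp only [Set.mem_setOf_eq, Field.absoluteGaloisGroup.smul_def, map_one]
  add_mem' {a b} ha hb := by
    simp only [Set.mem_setOf_eq, Field.absoluteGaloisGroup.smul_def] at ha hb ⊢
    rw [map_add, ha, hb]
  zero_mem' := by
    simp only [Set.mem_setOf_eq, Field.absoluteGaloisGroup.smul_def, map_zero]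
  neg_mem' {a} ha := by
    simp only [Set.mem_setOf_eq, Field.absoluteGaloisGroup.smul_def] at ha ⊢
    rw [map_neg, ha]
  inv_mem' a ha := by
    simp only [Set.mem_setOf_eq, Field.absoluteGaloisGroup.smul_def] at ha ⊢
    rw [map_inv₀, ha]

/-- Membership in the fixed field (by definition). [folklore] -/
private theorem mem_galoisFixedSubfield_iff (σ : Field.absoluteGaloisGroup K) (a : AlgebraicClosure K) :
    a ∈ galoisFixedSubfield σ ↔ σ • a = a := Iff.rfl

/-- `K ⊆` the fixed field of every `σ ∈ Γ_K` (`σ` is `K`-linear). [folklore] -/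
private theorem algebraMap_mem_galoisFixedSubfield (σ : Field.absoluteGaloisGroup K) (k : K) :
    algebraMap K (AlgebraicClosure K) k ∈ galoisFixedSubfield σ := by
  rw [mem_galoisFixedSubfield_iff, Field.absoluteGaloisGroup.smul_def]
  exact AlgEquiv.commutes _ k

/-- **An element of the ring class subgroup fixes the `jbar`-preimages of the singular moduli of
discriminant `d_K c²`** (unfolding of `ringClassSubgroup`, Cox Thm. 11.1: `K[c] = K(j(𝒪_c))`).
[cite: Cox2013, Thm. 11.1] -/
theorem smul_eq_self_of_mem_ringClassSubgroup_of_mem_image {c : ℕ} {jbar : AlgebraicClosure K →+* ℂ}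
    {σ : Field.absoluteGaloisGroup K} (hσ : σ ∈ ringClassSubgroup K c jbar) {a : AlgebraicClosure K}
    (ha : jbar a ∈ (reducedForms (NumberField.discr K * (c : ℤ) ^ 2)).image formJ) : σ • a = a := by
  simp only [ringClassSubgroup, Subgroup.mem_comap, Subgroup.mem_iInf] at hσ
  exact hσ a ha

/-- **The `jbar`-transfer: `Gal(K̄/K[c])` (the tree's `ringClassSubgroup K c jbar`) fixes every
`δ ∈ K̄` whose image `jbar δ` lies in the concrete ring class field `ringClassField K ι c ⊆ ℂ`,
`ι = jbar ∘ (K → K̄)`** (`K` imaginary quadratic, `c ≠ 0`). Proof: the `jbar`-image of the fixed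
field of `σ` is a subfield of `ℂ` containing `ι(K)` and — since every singular modulus is a value of
`jbar` (`mem_range_of_mem_ringClassField`) whose preimage `σ` fixes by definition — the singular moduli
of discriminant `c²d_K`, hence all of `K[c]`; `jbar` is injective. Cox Thm. 11.1 (`K[c] = K(j(𝒪_c))`).
[cite: Cox2013, Thm. 11.1] -/
theorem smul_eq_self_of_mem_ringClassSubgroup (hK : IsImaginaryQuadratic K)
    (jbar : AlgebraicClosure K →+* ℂ) {c : ℕ} (hc : c ≠ 0) {σ : Field.absoluteGaloisGroup K}
    (hσ : σ ∈ ringClassSubgroup K c jbar) {δ : AlgebraicClosure K}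
    (hδ : jbar δ ∈ ringClassField K (jbar.comp (algebraMap K (AlgebraicClosure K))) c) :
    σ • δ = δ := by
  set ι := jbar.comp (algebraMap K (AlgebraicClosure K)) with hι
  -- `K[c] ⊆ jbar(fixed field of σ)`
  have hle : ringClassField K ι c ≤ (galoisFixedSubfield σ).map jbar := by
    rw [ringClassField, Subfield.closure_le]
    rintro x (⟨k, rfl⟩ | hx)
    · exact ⟨algebraMap K (AlgebraicClosure K) k, algebraMap_mem_galoisFixedSubfield σ k, rfl⟩
    · have hxK : x ∈ ringClassField K ι c := ringClassSingularModuli_subset_ringClassField ι c hx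
      obtain ⟨a, rfl⟩ := mem_range_of_mem_ringClassField hK jbar hc hxK
      refine ⟨a, ?_, rfl⟩
      have ha : jbar a ∈ (reducedForms (NumberField.discr K * (c : ℤ) ^ 2)).image formJ := by
        rw [mul_comm]; exact Finset.mem_coe.mp hx
      exact smul_eq_self_of_mem_ringClassSubgroup_of_mem_image hσ ha
  obtain ⟨a, ha, hja⟩ := Subfield.mem_map.mp (hle hδ)
  rw [← jbar.injective hja]
  exact ha

end Range

/-! ## §2 The twisting transport `E′_{K̄} ≅ E_{K̄}` with coefficients in `ℚ(√d)` -/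

section Twist

variable {K : Type u} [Field K] [NumberField K]

variable (W W' : WeierstrassCurve ℚ) {d : ℚ} {C₁ C₀ : VariableChange ℚ} {δ : AlgebraicClosure K}

/-- **The twisting transport** `θ_C : E′_{K̄} ≅ E_{K̄}` for a `ℚ`-model `W′` of the quadratic twist
`W^{(d)}` (`C₀ • W^{(d)} = W′`) and a square root `δ = √d ∈ K̄ ∖ ℚ`: the change of variables
`C = (C₁)_{K̄}⁻¹ · (u = δ) · (C₀)_{K̄}⁻¹` over `K̄` — undo `C₀`, untwist by `u = δ` (Silverman X.5.4,
tree `twistUntwist_smul_baseChange`: `(u = δ) • W^{(d)} = W^{(1)}`), undo the completed square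
`C₁ • W = W^{(1)}` — with `C • E′_{K̄} = E_{K̄}` on the nose; its coefficients lie in `ℚ(δ)`.
[cite: SilvermanAEC2009, X.5 Cor. 5.4 (E^{(d)} ≅ E over F(√d)) and III.3.1(b)] -/
def GeomTransport.ofQuadraticTwist [NeZero (2 : ℚ)] (hC₁ : C₁ • W = W.quadraticTwist 1)
    (hW : C₀ • W.quadraticTwist d = W') (hδ : δ ∉ Set.range (algebraMap ℚ (AlgebraicClosure K)))
    (hδ2 : δ ^ 2 = algebraMap ℚ (AlgebraicClosure K) d) : GeomTransport W' W K where
  C := (C₁.map (algebraMap ℚ (AlgebraicClosure K)))⁻¹ * twistUntwist hδ *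
    (C₀.map (algebraMap ℚ (AlgebraicClosure K)))⁻¹
  smul_eq := by
    set φ := algebraMap ℚ (AlgebraicClosure K) with hφ
    -- `(V ⊗ K) ⊗ K̄ = V ⊗ K̄` (Mathlib `map_baseChange`; cf. the tree's
    -- `WeierstrassCurve.baseChange_baseChange_algebraicClosure_eq`, not imported here)
    have hbc : ∀ V : WeierstrassCurve ℚ, (V.baseChange K).baseChange (AlgebraicClosure K) =
        V.baseChange (AlgebraicClosure K) := fun V ↦
      (V.map_baseChange (IsScalarTower.toAlgHom ℚ K (AlgebraicClosure K)) : _)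
    rw [hbc, hbc]
    have h0 : (C₀.map φ)⁻¹ • W'.baseChange (AlgebraicClosure K) =
        (W.quadraticTwist d).baseChange (AlgebraicClosure K) := by
      rw [inv_smul_eq_iff, baseChange, baseChange, map_variableChange, hW]
    have h1 : (C₁.map φ)⁻¹ • (W.quadraticTwist 1).baseChange (AlgebraicClosure K) =
        W.baseChange (AlgebraicClosure K) := by
      rw [inv_smul_eq_iff, baseChange, baseChange, map_variableChange, hC₁]
    rw [mul_smul, mul_smul, h0, twistUntwist_smul_baseChange W hδ hδ2, h1]

/-- The coefficients of the twisting transport (by definition). [cite: SilvermanAEC2009, X.5 Cor. 5.4] -/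
theorem GeomTransport.ofQuadraticTwist_C [NeZero (2 : ℚ)] (hC₁ : C₁ • W = W.quadraticTwist 1)
    (hW : C₀ • W.quadraticTwist d = W') (hδ : δ ∉ Set.range (algebraMap ℚ (AlgebraicClosure K)))
    (hδ2 : δ ^ 2 = algebraMap ℚ (AlgebraicClosure K) d) :
    (GeomTransport.ofQuadraticTwist W W' hC₁ hW hδ hδ2).C =
      (C₁.map (algebraMap ℚ (AlgebraicClosure K)))⁻¹ * twistUntwist hδ *
        (C₀.map (algebraMap ℚ (AlgebraicClosure K)))⁻¹ :=
  rfl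

/-- A change of variables defined over `ℚ` is fixed by every ring endomorphism of `K̄` (ring maps fix
`ℚ`; Mathlib `RingHom.ext_rat`). [folklore] -/
private theorem variableChange_map_rat_map_eq (C : VariableChange ℚ)
    (g : AlgebraicClosure K →+* AlgebraicClosure K) :
    (C.map (algebraMap ℚ (AlgebraicClosure K))).map g = C.map (algebraMap ℚ (AlgebraicClosure K)) := by
  rw [VariableChange.map_map, RingHom.ext_rat (g.comp (algebraMap ℚ (AlgebraicClosure K)))
    (algebraMap ℚ (AlgebraicClosure K))]

/-- The untwisting substitution `(u = δ)` is fixed by every ring endomorphism of `K̄` fixing `δ`.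
[cite: SilvermanAEC2009, X.5 Cor. 5.4] -/
theorem twistUntwist_map_eq_self [NeZero (2 : ℚ)]
    (hδ : δ ∉ Set.range (algebraMap ℚ (AlgebraicClosure K)))
    {g : AlgebraicClosure K →+* AlgebraicClosure K} (hg : g δ = δ) :
    (twistUntwist hδ).map g = twistUntwist hδ := by
  simp only [twistUntwist, VariableChange.map, map_zero, VariableChange.mk.injEq, and_true]
  ext
  simp [hg]

/-- **Galois-fixedness of the twisting transport**: every ring endomorphism `g` of `K̄` with
`g δ = δ` fixes the coefficients of `C` (they lie in `ℚ(δ)`; `VariableChange.map g` is a group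
homomorphism, Mathlib `VariableChange.mapHom`). With `TwistedHeegnerTransportGalois`'s
`smul_equiv_eq_self_of` this is the `K[c]`-rationality of transported `K[c]`-rational points once
`Gal(K̄/K[c])` fixes `δ`. [cite: SilvermanAEC2009, X.2 Thm. 2.2 (proof: ι^σ = ι when σ fixes the coefficients) and X.5 Cor. 5.4] -/
theorem GeomTransport.ofQuadraticTwist_C_map_eq [NeZero (2 : ℚ)] (hC₁ : C₁ • W = W.quadraticTwist 1)
    (hW : C₀ • W.quadraticTwist d = W') (hδ : δ ∉ Set.range (algebraMap ℚ (AlgebraicClosure K)))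
    (hδ2 : δ ^ 2 = algebraMap ℚ (AlgebraicClosure K) d)
    {g : AlgebraicClosure K →+* AlgebraicClosure K} (hg : g δ = δ) :
    (GeomTransport.ofQuadraticTwist W W' hC₁ hW hδ hδ2).C.map g =
      (GeomTransport.ofQuadraticTwist W W' hC₁ hW hδ hδ2).C := by
  rw [GeomTransport.ofQuadraticTwist_C]
  change VariableChange.mapHom g _ = _
  rw [map_mul, map_mul, map_inv, map_inv]
  change ((C₁.map _).map g)⁻¹ * (twistUntwist hδ).map g * ((C₀.map _).map g)⁻¹ = _
  rw [variableChange_map_rat_map_eq, variableChange_map_rat_map_eq,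
    twistUntwist_map_eq_self hδ hg]

end Twist

/-! ## §3 `p*` is not a rational square -/

/-- **`p* = (−1)^{(p−1)/2} p` is not the square of a rational number** (`p` prime): for `p ≡ 3 (4)`
it is negative; for `p ≡ 1 (4)` (and `p = 2`), `√p` is irrational — Hardy–Wright Thm. 44 ("`ᵐ√N` is
irrational, unless `N` is the `m`-th power of an integer"; Mathlib `Nat.Prime.irrational_sqrt`).
[cite: HardyWright2008, §4.3 Thm. 44] -/
theorem not_exists_sq_eq_pStar {p : ℕ} (hp : p.Prime) :
    ¬ ∃ q : ℚ, q ^ 2 = (-1 : ℚ) ^ (p / 2) * p := by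
  rintro ⟨q, hq⟩
  rcases neg_one_pow_eq_or ℚ (p / 2) with h1 | h1
  · rw [h1, one_mul] at hq
    have hirr := hp.irrational_sqrt
    refine hirr ⟨|q|, ?_⟩
    have hq' : ((|q| : ℚ) : ℝ) ^ 2 = (p : ℝ) := by
      rw [Rat.cast_abs, sq_abs, ← Rat.cast_pow, hq, Rat.cast_natCast]
    rw [← Real.sqrt_sq (by positivity : (0 : ℝ) ≤ ((|q| : ℚ) : ℝ)), hq']
  · rw [h1, neg_one_mul] at hq
    have h0 : (0 : ℚ) < p := by exact_mod_cast hp.pos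
    nlinarith [sq_nonneg q]

/-- Hence a square root `δ` of `p*` in any field of characteristic `0` is irrational:
`δ ∉ ℚ ⊆ L` (Hardy–Wright Thm. 44 read in `L`). [cite: HardyWright2008, §4.3 Thm. 44] -/
theorem not_mem_range_algebraMap_of_sq_eq_pStar {L : Type*} [Field L] [CharZero L] {p : ℕ}
    (hp : p.Prime) {δ : L} (hδ2 : δ ^ 2 = algebraMap ℚ L ((-1 : ℚ) ^ (p / 2) * p)) :
    δ ∉ Set.range (algebraMap ℚ L) := by
  rintro ⟨q, rfl⟩
  rw [← map_pow] at hδ2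
  exact not_exists_sq_eq_pStar hp ⟨q, (algebraMap ℚ L).injective hδ2⟩

/-! ## §4 Non-vacuity of `TwistedHeegnerFamily` -/

section Existence

variable {K : Type} [Field K] [NumberField K] {N' : ℕ} [NeZero N'] {W W' : WeierstrassCurve ℚ}
  {p : ℕ} [Fact p.Prime]

/-- **A square root of `p*` in `K̄` maps into every ring class field `K[p^{j+1}]`** (for `K`
imaginary quadratic, `p` odd, `p ∤ d_K`, CONDITIONALLY on `sqrt_pStar_mem_ringClassField`): the fact
gives `θ ∈ K[p]` with `θ² = p*`, so `jbar δ = ±θ ∈ K[p]`, and `K[p] ⊆ K[p^{j+1}]` is the tree's tower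
theorem `ringClassField_mono` (Cox §9.A). [cite: CornutVatsal2007, §1.1 ¶"Ring class characters"]
[cite: Cox2013, §9.A and Thm. 11.1 (the tower K[m] ⊆ K[n], m ∣ n)] -/
theorem apply_mem_ringClassField_pow_of_sq_eq_pStar (hG : sqrt_pStar_mem_ringClassField)
    (hK : IsImaginaryQuadratic K) (hp2 : p ≠ 2) (hpd : ¬ (p : ℤ) ∣ NumberField.discr K)
    (jbar : AlgebraicClosure K →+* ℂ) {δ : AlgebraicClosure K}
    (hδ2 : δ ^ 2 = algebraMap ℚ (AlgebraicClosure K) ((-1 : ℚ) ^ (p / 2) * p)) (j : ℕ) :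
    jbar δ ∈ ringClassField K (jbar.comp (algebraMap K (AlgebraicClosure K))) (p ^ (j + 1)) := by
  have hp : p.Prime := Fact.out
  set ι := jbar.comp (algebraMap K (AlgebraicClosure K)) with hι
  obtain ⟨θ, hθ2, -⟩ := hG K hK ι p hp hp2 hpd
  have hθ2' : ((θ : ℂ)) ^ 2 = (((-1 : ℚ) ^ (p / 2) * p : ℚ) : ℂ) := by
    have := congrArg Subtype.val hθ2
    simpa using this
  have hδ2' : (jbar δ) ^ 2 = (((-1 : ℚ) ^ (p / 2) * p : ℚ) : ℂ) := by
    rw [← map_pow, hδ2]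
    exact map_ratCast jbar _
  have hmem : jbar δ ∈ ringClassField K ι p := by
    rcases sq_eq_sq_iff_eq_or_eq_neg.mp (hδ2'.trans hθ2'.symm) with h | h
    · rw [h]; exact θ.2
    · rw [h]; exact neg_mem θ.2
  exact ringClassField_mono hK ι (dvd_pow_self p (Nat.succ_ne_zero j)) (pow_ne_zero _ hp.ne_zero) hmem

/-- **Twisted Heegner families exist** (non-vacuity of `TwistedHeegnerFamily N′ W W′ K κ jbar`;
OPEN-QUESTIONS-06 Q-D4). Let `E′ = W′` be an elliptic curve over `ℚ` that is a `ℚ`-model of the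
quadratic twist of `E = W` by `p* = (−1)^{(p−1)/2} p` (`C₀ • W^{(p*)} = W′`), `p` an odd prime, `K`
imaginary quadratic satisfying the Heegner hypothesis for `N′` with `p ∤ N′` and `p ∤ d_K`. Then for
every `ℤ_p`-extension `κ`, parametrisation datum `Dt′` of `E′` at level `N′`, orientation `β`
(`β² ≡ d_K (mod 4N′)`) and embedding `jbar : K̄ → ℂ` there is a twisted Heegner family: the
transported norm points `z_j = ∑_{σ ∈ Gal(K[p^{j+1}]/K_j)} σ · θ_C(P′[p^{j+1}])` of the Heegner points
of `E′` along the twisting transport `θ_C` (`GeomTransport.ofQuadraticTwist`, coefficients in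
`ℚ(√p*) ⊆ K[p] ⊆ K[p^{j+1}]`). CONDITIONAL on exactly the two refereed named facts
`exists_isHeegnerNormPoint N′ W′ K p` (Howard 2004 §2.7/§3.3: `P[m] ∈ E(K[m])` and its norms) and
`sqrt_pStar_mem_ringClassField` (Cornut–Vatsal 2007 §1.1 + Cox: `√p* ∈ K[p]`); the construction is the
one named in Keller–Yin arXiv:2410.23241v1, proof of Thm. 3.3.5 ("these images are nothing but the
`z_{f,𝒪}` in [CastellaHsieh] where their `χ` is our `χ_ε`") = Castella–Hsieh 2018 §4.4, read at
Case (I) for an elliptic curve. [cite: Howard2004HeegnerKolyvagin, §2.7 and §3.3 (P[m] ∈ E(K[m]); P_k = Norm P[p^{k+1}])]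
[cite: CastellaHsieh2018, §4.4 (the χ-components z_{f,χ,c} of the Heegner classes)]
[cite: SilvermanAEC2009, X.5 Cor. 5.4] -/
theorem nonempty_twistedHeegnerFamily_of [W'.IsElliptic] (hH : exists_isHeegnerNormPoint N' W' K p)
    (hG : sqrt_pStar_mem_ringClassField) (hK : IsImaginaryQuadratic K)
    (hHN : SatisfiesHeegnerHypothesis N' K) (hpN : ¬ p ∣ N') (hp2 : p ≠ 2)
    (hpd : ¬ (p : ℤ) ∣ NumberField.discr K) {C₀ : VariableChange ℚ}
    (hW : C₀ • W.quadraticTwist ((-1 : ℚ) ^ (p / 2) * p) = W') (κ : ZpExtension K p)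
    (Dt : ModularParametrizationData W' N') {β : ℤ} (hβ : (4 * N' : ℤ) ∣ β ^ 2 - NumberField.discr K)
    (jbar : AlgebraicClosure K →+* ℂ) : Nonempty (TwistedHeegnerFamily N' W W' K κ jbar) := by
  have hp : p.Prime := Fact.out
  set ι := jbar.comp (algebraMap K (AlgebraicClosure K)) with hι
  -- a square root `δ` of `p*` in `K̄`, from the genus datum `θ = √p* ∈ K[p] ⊆ ℂ`
  obtain ⟨θ, hθ2, -⟩ := hG K hK ι p hp hp2 hpd
  obtain ⟨δ, hδθ⟩ : (θ : ℂ) ∈ Set.range jbar :=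
    mem_range_of_mem_ringClassField hK jbar hp.ne_zero θ.2
  have hδ2 : δ ^ 2 = algebraMap ℚ (AlgebraicClosure K) ((-1 : ℚ) ^ (p / 2) * p) := by
    have hθ2' : ((θ : ℂ)) ^ 2 = (((-1 : ℚ) ^ (p / 2) * p : ℚ) : ℂ) := by
      have := congrArg Subtype.val hθ2
      simpa using this
    apply jbar.injective
    rw [map_pow, hδθ, hθ2']
    exact (map_ratCast jbar _).symm
  have hδ : δ ∉ Set.range (algebraMap ℚ (AlgebraicClosure K)) :=
    not_mem_range_algebraMap_of_sq_eq_pStar hp hδ2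
  -- the twisting transport, coefficients in `ℚ(δ)`
  obtain ⟨C₁, hC₁⟩ := W.exists_variableChange_quadraticTwist_one
  let T : GeomTransport W' W K := GeomTransport.ofQuadraticTwist W W' hC₁ hW hδ hδ2
  have hT : ∀ j, ∀ σ ∈ ringClassSubgroup K (p ^ (j + 1)) jbar,
      T.C.map (GeomTransport.galHom σ : AlgebraicClosure K →+* AlgebraicClosure K) = T.C :=
    fun j σ hσ ↦ GeomTransport.ofQuadraticTwist_C_map_eq W W' hC₁ hW hδ hδ2
      (smul_eq_self_of_mem_ringClassSubgroup hK jbar (pow_ne_zero _ hp.ne_zero) hσ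
        (apply_mem_ringClassField_pow_of_sq_eq_pStar hG hK hp2 hpd jbar hδ2 j))
  -- the norm points of the Heegner points of `E′`, transported
  have hz : ∀ j, ∃ z, IsTwistedHeegnerNormPoint N' W W' K κ Dt β T jbar j (p ^ (j + 1)) z := by
    intro j
    have hc : (p ^ (j + 1)).Coprime N' :=
      Nat.Coprime.pow_left _ (hp.coprime_iff_not_dvd.mpr hpN)
    obtain ⟨-, x', R, hx', hfix, hRsub, htrans, -⟩ := hH hK hHN κ Dt hβ jbar j hc
    exact ⟨∑ r ∈ R, r • T.equiv x', x', R, hx', hfix,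
      GeomTransport.smul_equiv_eq_self_of T (hT j) hfix, hRsub, htrans, rfl⟩
  choose z hz using hz
  exact ⟨⟨Dt, β, hβ, T, z, hz⟩⟩

end Existence

end Literature.NumberTheory.EllipticCurves

end
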